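import Summits.CriticalPhenomena.Ising3DConformalLimit.Theses.CoerciveSharpness
import Summits.CriticalPhenomena.Ising3DConformalLimit.Theses.ClusterRigidity
import Summits.CriticalPhenomena.Ising3DConformalLimit.Theses.HelsonAxis
import Summits.CriticalPhenomena.Ising3DConformalLimit.Theorems.CoerciveSharpnessDimensionPinnedPointwiseTransfer
import Summits.CriticalPhenomena.Ising3DConformalLimit.Theorems.PrecisionLaplacianInverseMCriticalKernel
import Literature.Probability.LatticeModels.PointwiseScalingLimitEtaExists
import HarnessLib

/-!
# Line `torus-fss-dock` for the crux `CoerciveSharpness.DimensionPinned` (item stmt-CriticalPhenomena-4662;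
# shared with `ClusterRigidity.DimensionPinned`, `HelsonAxis.EtaBoundsExist`) — strategist r1 skeleton

The crux, verbatim: `DimensionPinned := ∃ η : ℝ, HasIsingEtaBounds 3 η` (two-sided pure-power bounds
`c‖x‖^{-(1+η)} ≤ ⟨σ₀σ_x⟩_{β_c(3)} ≤ C‖x‖^{-(1+η)}`, `x ≠ 0`, sup norm).

Second dock of the crux (the first is the lead's line `Sketch`: block-covariance rate `DCR₂₇` docked to
item stmt-CriticalPhenomena-18762). This line docks the crux to the FINITE-SIZE-SCALING form in which every
finite-volume engine (computer-assisted / tensor renormalisation on tori, card `tensor-rg-dilatation-certificate`;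
transfer-matrix FSS; certified numerics scale by scale) states its output: a torus-uniform geometric rate
for the dyadic ratio of the periodic critical two-point function,

  `C⁺ = TorusUniformDyadicRate`:  `∃ Δ θ C A, 0 < θ < 1, 1 ≤ A, ∀ k, ∀ N + 1 ≥ A·2^{k+1},
      | ⟨σ₀σ_{2^{k+1}e₀}⟩_{𝕋_{N+1};β_c(3)} · 4^Δ / ⟨σ₀σ_{2^k e₀}⟩_{𝕋_{N+1};β_c(3)} − 1 | ≤ C θ^k`.

Informal notation: `g n := criticalTwoPoint 3 (n e₀)` (infinite volume, plus = free state at `β_c`),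
`g_N n := isingTorusTwoPoint 3 (N+1) (criticalBeta 3) 0 (proj 0) (proj (n e₀))` (torus `(ℤ/(N+1)ℤ)³`).
Everything is WRITTEN OUT in the statements (no local definition enters a stub signature).

* `stub_torusUniformDyadicRate` — **the OPEN input C⁺** (torus FSS rate; the native output of a certified
  finite-volume renormalisation: hyperbolic fixed point ⟹ geometric corrections to scaling, read on tori).
* `stub_thermodynamicLimit` — C⁺ ⟹ the pointwise dyadic geometric law
  `|g(2^{k+1}) 4^Δ / g(2^k) − 1| ≤ C θ^k` (pass `N → ∞` at fixed `k` with the tree's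
  `tendsto_isingTorusTwoPoint_criticalTwoPoint`, `m*(β_c) = 0`; provable now, M−).
* `stub_geometricLawRate` — the pointwise geometric law ⟹ `OctaveRatioRate`
  (`|log g(2^{k+2}) − 2 log g(2^{k+1}) + log g(2^k)| ≤ C' (2^k)^{-θ'}`): logs of near-one ratios,
  geometric ↔ power rate (`θ^k = (2^k)^{log₂ θ}`); pure real analysis, provable now, M−.
* composition `DimensionPinned_of` — through the LANDED pointwise port
  `Theorems.CoerciveSharpnessDimensionPinned.stub_pointwiseTransfer` (p162779, line `Sketch`).

Why a torus dock is not the `Sketch` dock reworded: its open input lives on FINITE tori (exactly contractible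
objects, aspect ratio `A` fixed), not on the infinite-volume measure; it needs no coupling / joining of two
copies of `μ_{β_c}` (stmt-18762), and conversely a joining gives no torus statement. Both inputs are
cross-scale RATES, as any proof of this crux must be (CensusWeb `dimensionPinned_iff_scaleMult`;
Disproof §5 `exists_octaveRatioLimit_not_profilePinned`: a ratio LIMIT without rate does not pin).

UNION SKELETON (the item has ONE skeleton slot): `stub_dilationCovarianceRate` of line `Sketch` is carried
verbatim as stub 4 with its own composition `DimensionPinned_of_dcr` (landed `stub_transfer`), so registering
this file keeps BOTH open inputs of the crux active: {DCR₂₇ ⟸ stmt-18762, TorusUniformDyadicRate ⟸ FSS engine}.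
STATUS (strategist r1, 2026-08-17): stubs 2–3 and `dimensionPinned_of_torusUniformDyadicRate` PROVED, proposed
p167707 (`Theorems/CoerciveSharpnessDimensionPinnedTorusDock.lean`, --supports stmt-CriticalPhenomena-4662).
-/

noncomputable section

namespace Summit.CriticalPhenomena.Ising3DConformalLimit.Cruxes.DimensionPinned.TorusFSSDock

open scoped BigOperators
open Filter Topology
open Literature.Probability.LatticeModels
open Summit.CriticalPhenomena.Ising3DConformalLimit.Theses.CoerciveSharpness (DimensionPinned)

/-! ### The registered stubs -/

/-- **stub 1 — `TorusUniformDyadicRate`, the open input of the line (C⁺).** On the tori `(ℤ/(N+1)ℤ)³` of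
aspect ratio at least `A` over the scale `2^{k+1}`, the dyadic ratio of the periodic critical two-point
function along `e₀` is `4^{-Δ}` up to a GEOMETRIC error `C θ^k`, uniformly in `N`. -/
theorem stub_torusUniformDyadicRate :
    ∃ Δ θ C : ℝ, ∃ A : ℕ, 0 < θ ∧ θ < 1 ∧ 1 ≤ A ∧ ∀ k N : ℕ, A * 2 ^ (k + 1) ≤ N + 1 →
      |isingTorusTwoPoint 3 (N + 1) (criticalBeta 3) 0 (Torus.proj (N + 1) 0)
            (Torus.proj (N + 1) (Pi.single 0 ((2 ^ (k + 1) : ℕ) : ℤ))) * (4 : ℝ) ^ Δ /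
          isingTorusTwoPoint 3 (N + 1) (criticalBeta 3) 0 (Torus.proj (N + 1) 0)
            (Torus.proj (N + 1) (Pi.single 0 ((2 ^ k : ℕ) : ℤ))) - 1| ≤ C * θ ^ k := by
  sorry

/-- **stub 2 — thermodynamic limit.** The torus-uniform dyadic rate passes to the infinite-volume critical
two-point function: `|g(2^{k+1}) 4^Δ / g(2^k) − 1| ≤ C θ^k` for every `k`
(`⟨σ_{p̄}σ_{q̄}⟩_{𝕋_{N+1};β_c} → criticalTwoPoint 3 (q - p)`, tree `tendsto_isingTorusTwoPoint_criticalTwoPoint`,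
and `criticalTwoPoint_axis_pos`). -/
theorem stub_thermodynamicLimit :
    (∃ Δ θ C : ℝ, ∃ A : ℕ, 0 < θ ∧ θ < 1 ∧ 1 ≤ A ∧ ∀ k N : ℕ, A * 2 ^ (k + 1) ≤ N + 1 →
      |isingTorusTwoPoint 3 (N + 1) (criticalBeta 3) 0 (Torus.proj (N + 1) 0)
            (Torus.proj (N + 1) (Pi.single 0 ((2 ^ (k + 1) : ℕ) : ℤ))) * (4 : ℝ) ^ Δ /
          isingTorusTwoPoint 3 (N + 1) (criticalBeta 3) 0 (Torus.proj (N + 1) 0)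
            (Torus.proj (N + 1) (Pi.single 0 ((2 ^ k : ℕ) : ℤ))) - 1| ≤ C * θ ^ k) →
    ∃ Δ θ C : ℝ, 0 < θ ∧ θ < 1 ∧ ∀ k : ℕ,
      |criticalTwoPoint 3 (Pi.single 0 ((2 ^ (k + 1) : ℕ) : ℤ)) * (4 : ℝ) ^ Δ /
          criticalTwoPoint 3 (Pi.single 0 ((2 ^ k : ℕ) : ℤ)) - 1| ≤ C * θ ^ k := by
  sorry

/-- **stub 3 — a geometric dyadic law is an octave-ratio rate.** From `|g(2^{k+1}) 4^Δ/g(2^k) − 1| ≤ C θ^k`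
(`0 < θ < 1`) to the second-dyadic-difference power rate consumed by the landed pointwise port:
`|log g(2^{k+2}) − 2 log g(2^{k+1}) + log g(2^k)| ≤ C' (2^k)^{-θ'}` with `θ' = -log₂ θ > 0`. -/
theorem stub_geometricLawRate :
    (∃ Δ θ C : ℝ, 0 < θ ∧ θ < 1 ∧ ∀ k : ℕ,
      |criticalTwoPoint 3 (Pi.single 0 ((2 ^ (k + 1) : ℕ) : ℤ)) * (4 : ℝ) ^ Δ /
          criticalTwoPoint 3 (Pi.single 0 ((2 ^ k : ℕ) : ℤ)) - 1| ≤ C * θ ^ k) →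
    ∃ θ C : ℝ, 0 < θ ∧ ∀ k : ℕ,
      |Real.log (criticalTwoPoint 3 (Pi.single 0 ((2 ^ (k + 2) : ℕ) : ℤ))) -
          2 * Real.log (criticalTwoPoint 3 (Pi.single 0 ((2 ^ (k + 1) : ℕ) : ℤ))) +
        Real.log (criticalTwoPoint 3 (Pi.single 0 ((2 ^ k : ℕ) : ℤ)))| ≤ C * ((2:ℝ) ^ k) ^ (-θ) := by
  sorry

/-- **stub 4 — `DCR₂₇`, the open input of the lead's line `Sketch`, carried VERBATIM** (same name and
signature as in `Lines/Sketch.lean`, so that ONE registered skeleton keeps BOTH docks of this crux active: the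
item has a single skeleton slot).  Power-rate Cauchy property of the 27 nearest normalised block covariances
of `criticalTwoPoint 3` under `L ↦ 2L`; engine: item stmt-CriticalPhenomena-18762 (`DilationJoinings`) via the
landed `stub_dock`.  It feeds the second composition `DimensionPinned_of_dcr` below (landed `stub_transfer`). -/
theorem stub_dilationCovarianceRate :
    ∃ θ C : ℝ, 0 < θ ∧ ∀ L : ℕ, 1 ≤ L → ∀ u : Fin 3 → ℤ, (∀ i, |u i| ≤ 1) →
      |(∑ x ∈ Fintype.piFinset (fun _ : Fin 3 => Finset.Ico (0:ℤ) (2 * (L:ℤ))),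
          ∑ y ∈ Fintype.piFinset (fun i : Fin 3 => Finset.Ico (2 * (L:ℤ) * u i) (2 * (L:ℤ) * u i + 2 * (L:ℤ))),
            criticalTwoPoint 3 (y - x)) /
        (∑ x ∈ Fintype.piFinset (fun _ : Fin 3 => Finset.Ico (0:ℤ) (2 * (L:ℤ))),
          ∑ y ∈ Fintype.piFinset (fun _ : Fin 3 => Finset.Ico (0:ℤ) (2 * (L:ℤ))), criticalTwoPoint 3 (y - x)) -
       (∑ x ∈ Fintype.piFinset (fun _ : Fin 3 => Finset.Ico (0:ℤ) (L:ℤ)),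
          ∑ y ∈ Fintype.piFinset (fun i : Fin 3 => Finset.Ico ((L:ℤ) * u i) ((L:ℤ) * u i + (L:ℤ))),
            criticalTwoPoint 3 (y - x)) /
        (∑ x ∈ Fintype.piFinset (fun _ : Fin 3 => Finset.Ico (0:ℤ) (L:ℤ)),
          ∑ y ∈ Fintype.piFinset (fun _ : Fin 3 => Finset.Ico (0:ℤ) (L:ℤ)), criticalTwoPoint 3 (y - x))|
      ≤ C * (L : ℝ) ^ (-θ) := by
  sorry

/-! ### Skeleton-local abbreviations of the stub statements (NOT registered; signatures above are written out) -/

/-- Statement of `stub_torusUniformDyadicRate` (C⁺). -/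
def TorusUniformDyadicRate : Prop :=
    ∃ Δ θ C : ℝ, ∃ A : ℕ, 0 < θ ∧ θ < 1 ∧ 1 ≤ A ∧ ∀ k N : ℕ, A * 2 ^ (k + 1) ≤ N + 1 →
      |isingTorusTwoPoint 3 (N + 1) (criticalBeta 3) 0 (Torus.proj (N + 1) 0)
            (Torus.proj (N + 1) (Pi.single 0 ((2 ^ (k + 1) : ℕ) : ℤ))) * (4 : ℝ) ^ Δ /
          isingTorusTwoPoint 3 (N + 1) (criticalBeta 3) 0 (Torus.proj (N + 1) 0)
            (Torus.proj (N + 1) (Pi.single 0 ((2 ^ k : ℕ) : ℤ))) - 1| ≤ C * θ ^ k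

/-- Statement of the pointwise dyadic geometric law (output of stub 2, input of stub 3). -/
def DyadicGeometricLaw : Prop :=
    ∃ Δ θ C : ℝ, 0 < θ ∧ θ < 1 ∧ ∀ k : ℕ,
      |criticalTwoPoint 3 (Pi.single 0 ((2 ^ (k + 1) : ℕ) : ℤ)) * (4 : ℝ) ^ Δ /
          criticalTwoPoint 3 (Pi.single 0 ((2 ^ k : ℕ) : ℤ)) - 1| ≤ C * θ ^ k

/-- Statement of the octave-ratio rate (output of stub 3 = hypothesis of the landed port). -/
def OctaveRatioRate : Prop :=
    ∃ θ C : ℝ, 0 < θ ∧ ∀ k : ℕ,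
      |Real.log (criticalTwoPoint 3 (Pi.single 0 ((2 ^ (k + 2) : ℕ) : ℤ))) -
          2 * Real.log (criticalTwoPoint 3 (Pi.single 0 ((2 ^ (k + 1) : ℕ) : ℤ))) +
        Real.log (criticalTwoPoint 3 (Pi.single 0 ((2 ^ k : ℕ) : ℤ)))| ≤ C * ((2:ℝ) ^ k) ^ (-θ)

/-! ### Composition -/

/-- **The composition of the line**: C⁺ and the two transfer stubs give the crux BY NAME
(`ClusterRigidity.DimensionPinned`, the item's home decl; the three decls of the shared item are the
same term), through the LANDED pointwise port `stub_pointwiseTransfer` (p162779). -/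
theorem DimensionPinned_of (h1 : TorusUniformDyadicRate)
    (h2 : TorusUniformDyadicRate → DyadicGeometricLaw) (h3 : DyadicGeometricLaw → OctaveRatioRate) :
    Summit.CriticalPhenomena.Ising3DConformalLimit.Theses.ClusterRigidity.DimensionPinned :=
  Summit.CriticalPhenomena.Ising3DConformalLimit.Theorems.CoerciveSharpnessDimensionPinned.stub_pointwiseTransfer
    (h3 (h2 h1))

/-- The crux by name from the three stubs. -/
theorem DimensionPinned_proof :
    Summit.CriticalPhenomena.Ising3DConformalLimit.Theses.ClusterRigidity.DimensionPinned :=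
  DimensionPinned_of stub_torusUniformDyadicRate stub_thermodynamicLimit stub_geometricLawRate

/-- The same, typed as the bet route's decl `CoerciveSharpness.DimensionPinned`. -/
theorem DimensionPinned_proof_coerciveSharpness : DimensionPinned :=
  DimensionPinned_of stub_torusUniformDyadicRate stub_thermodynamicLimit stub_geometricLawRate

/-- The same, typed as `HelsonAxis.EtaBoundsExist`. -/
theorem EtaBoundsExist_proof :
    Summit.CriticalPhenomena.Ising3DConformalLimit.Theses.HelsonAxis.EtaBoundsExist :=
  DimensionPinned_of stub_torusUniformDyadicRate stub_thermodynamicLimit stub_geometricLawRate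

/-- **The torus transfer** `TorusUniformDyadicRate → DimensionPinned` (modulo the two provable stubs). -/
theorem torusTransfer_of (h2 : TorusUniformDyadicRate → DyadicGeometricLaw)
    (h3 : DyadicGeometricLaw → OctaveRatioRate) : TorusUniformDyadicRate → DimensionPinned :=
  fun h1 => DimensionPinned_of h1 h2 h3

/-! ### The other dock (line `Sketch`, lead): DCR₂₇ → crux through the LANDED block transfer -/

/-- **Second composition**: the lead's open input `stub_dilationCovarianceRate` (DCR₂₇) alone gives the crux
by name, through the LANDED `Theorems.CoerciveSharpnessDimensionPinned.stub_transfer` (p162260). -/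
theorem DimensionPinned_of_dcr :
    Summit.CriticalPhenomena.Ising3DConformalLimit.Theses.ClusterRigidity.DimensionPinned :=
  Summit.CriticalPhenomena.Ising3DConformalLimit.Theorems.CoerciveSharpnessDimensionPinned.stub_transfer
    stub_dilationCovarianceRate

end Summit.CriticalPhenomena.Ising3DConformalLimit.Cruxes.DimensionPinned.TorusFSSDock
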